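import Literature.NumberTheory.EllipticCurves.NewformPeterssonSizeSymmSqLZeroFreeProofs
import Literature.NumberTheory.LFunctions.SiegelExceptionalZeroBound
import HarnessLib

/-!
# Sketch — first lemmas of the two crux ideas for `DefiniteXi.PeterssonLowerBound` (stmt-ABC-10870)

Signatures only (`sorry`); they must ELABORATE over existing declarations.

* Card `dihedral-branch-dirichlet-split`:
  `symmSqL_one_lower_bound_of_nonneg_at` (Estermann needs only a point where `L_f ≥ 0`) and
  `symmSqL_one_lower_bound_of_dirichlet_realZero` (a real zero of a quadratic Dirichlet `L`-function lying to
  the right of the last real zero of `L_f` transfers MV Cor. 11.15 to `f`) — both provable NOW from the tree.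
* Card `gl3-core-fe-free-gamma-kernel`:
  `norm_apply_one_le_of_strip_bound` (value at `1` from a uniform strip bound with exponential allowance in
  `Im s`, via the Mellin kernel `Γ(w)Γ(w+1)^{m-1}`) and the local positivity `pair_log_coeff_nonneg`.
-/

noncomputable section

open Complex Filter Topology Set Metric CongruenceSubgroup
open Literature.NumberTheory.EllipticCurves.ModularForms
open Literature.NumberTheory.LFunctions

namespace Summit.ABC.ABC.Cruxes.PeterssonLowerBound.Sketch

/-- **Card 1, first lemma (a).** Estermann's disc lemma for `H = riemannZeta₁ · L_f` needs only
`0 ≤ Re H(β)`, i.e. `L_f(β) ≥ 0` (since `(β-1)ζ(β) > 0` on `(0,1)`): for every normalised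
`f ∈ S₂(Γ₀(N))` and every `β ∈ [1-η₀, 1)` with `L_f(β) ≥ 0`,
`C (1-β) (N¹⁵ max(1, L_f(1)))^{-A(1-β)} ≤ L_f(1)`. (Tree: `exists_symmSqL_estermann_ineq` is the special case
"`L_f` zero-free on `[1-δ,1)`"; same proof with `EstermannDisc.estermann_lemma_disc`, `symmSqL_coeff₁`,
`exists_norm_symmSqL_le`, `riemannZeta_ofReal` negativity from `ZetaRealAxis`.) -/
theorem symmSqL_one_lower_bound_of_nonneg_at :
    ∃ η₀ A C : ℝ, 0 < η₀ ∧ 0 < A ∧ 0 < C ∧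
      ∀ (N : ℕ) [NeZero N] (f : CuspForm (Gamma0 N) 2), cuspCoeff f 1 = 1 →
        ∀ β : ℝ, 1 - η₀ ≤ β → β < 1 → 0 ≤ (symmSqL N f β).re →
          C * (1 - β) * ((N : ℝ) ^ (15 : ℝ) * max 1 (symmSqL N f 1).re) ^ (-(A * (1 - β))) ≤
            (symmSqL N f 1).re := by
  sorry

/-- **Card 1, first lemma (b) = (D1).** If a quadratic Dirichlet character `χ mod D`, `D ≤ N²`, has a real
zero `β ∈ [1-η, 1)` and `L_f` has no real zero on `(β, 1)` (so `L_f(β) ≥ 0` by continuity and `L_f(1) > 0`),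
then `L_f(1) ≥ c(ε) N^{-ε}`: Estermann at `β` (lemma (a)) with `1 - β ≥ C(ε') D^{-ε'}`
(`SiegelExceptionalZeroBound.exists_one_sub_realZero_ge`, MV Cor. 11.15, PROVED). For a DIHEDRAL `f`
(`a_p = 0` at the primes inert in `K = ℚ(√-D)`), the real zeros of `L_f` that come from the factor `L(s, χ_K)`
are thereby discharged; the residual dihedral case is a real zero of `M_f = L_f/L(χ_K)` (card text). -/
theorem symmSqL_one_lower_bound_of_dirichlet_realZero :
    ∀ ε : ℝ, 0 < ε → ∃ η c : ℝ, 0 < η ∧ 0 < c ∧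
      ∀ (N : ℕ) [NeZero N] (f : CuspForm (Gamma0 N) 2), cuspCoeff f 1 = 1 →
      ∀ (D : ℕ) [NeZero D] (χ : DirichletCharacter ℂ D), χ ≠ 1 → χ ^ 2 = 1 →
        (D : ℝ) ≤ (N : ℝ) ^ (2 : ℝ) →
        ∀ β : ℝ, 1 - η ≤ β → β < 1 → DirichletCharacter.LFunction χ β = 0 →
          (∀ σ : ℝ, β < σ → σ < 1 → symmSqL N f σ ≠ 0) →
            c * (N : ℝ) ^ (-ε) ≤ (symmSqL N f 1).re := by
  sorry

/-- **Card 2, first lemma (a): the `Γ(w)^m`-kernel value bound (no functional equation).** If a Dirichlet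
series with `‖a n‖ ≤ C n^δ` continues holomorphically to `Re s > 1/2` with a bound that is uniform (polynomial)
in the conductor but may grow like `e^{κ|Im s|}` — which is what a Rankin–Selberg integral representation
gives after dividing by the Gamma factors — then its value at `s = 1` is `≤ K(δ,κ) (C+1) B^{4δ}`: smooth with
the weight whose Mellin transform is `Γ(w)Γ(w+1)^{m-1}` (simple pole at `0`, decay `e^{-mπ|v|/2}`),
`mπ/2 > κ`, and shift to `Re w = -1/2`. Supplies the field
`P_one_le` (`|P_ij(1)| ≪_δ (Q_iQ_j)^δ`) of `SiegelPairFamilyData` from the disc/strip bound alone. -/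
theorem norm_apply_one_le_of_strip_bound (δ κ : ℝ) (hδ : 0 < δ) (hδ1 : δ ≤ 1 / 4) (hκ : 0 ≤ κ) :
    ∃ K : ℝ, 0 < K ∧ ∀ (a : ℕ → ℂ) (F : ℂ → ℂ) (B C : ℝ), 1 ≤ B → 0 ≤ C →
      (∀ n : ℕ, ‖a n‖ ≤ C * (n : ℝ) ^ δ) →
      DifferentiableOn ℂ F {s : ℂ | 1 / 2 < s.re} →
      (∀ s : ℂ, 1 + 2 * δ ≤ s.re → F s = LSeries a s) →
      (∀ s : ℂ, 1 / 2 < s.re → s.re ≤ 3 → ‖F s‖ ≤ B * Real.exp (κ * |s.im|)) →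
        ‖F 1‖ ≤ K * (C + 1) * B ^ (4 * δ) := by
  sorry

/-- **Card 2, first lemma (b): local positivity of the pair coefficients** (Goldfeld, Lemma 8.7.5): at a good
prime the `p^k`-log-coefficient of `ζ·L(Sym² f)·L(Sym² g)·L(Sym² f × Sym² g) = L((f⊠g)×(f⊠g)~)` is
`(2 + 2cos 2kθ_p)(2 + 2cos 2kφ_p)/k ≥ 0` (Ramanujan at good primes = Hasse for elliptic curves). -/
theorem pair_log_coeff_nonneg (x y : ℝ) : 0 ≤ (2 + 2 * Real.cos x) * (2 + 2 * Real.cos y) :=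
  mul_nonneg (by linarith [Real.neg_one_le_cos x]) (by linarith [Real.neg_one_le_cos y])

end Summit.ABC.ABC.Cruxes.PeterssonLowerBound.Sketch

end
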